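import Literature.NumberTheory.NumberFields.FrobeniusClassGroupUnramified
import Literature.NumberTheory.GaloisRepresentations.HeckeCharacterGaloisAvatarProofs
import HarnessLib

/-!
# The Hilbert class field of a number field: unramified, and only principal primes split completely
# (Hilbert's Theorem 94 / Cox Thm. 8.10), from the tree's PROVED global class field theory

Topic `NumberTheory/NumberFields` (class field theory).  Theorem-only file (no definition, no named
fact, D-0026), unconditional.  Inputs, all theorems of the tree: Artin reciprocity for characters
(`artinReciprocity_character_holds`, and its primitive form
`Literature.NumberTheory.Automorphic.artinReciprocity_character_primitive_holds`), Tate's Key Lemma and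
induction (`exists_cyclic_charHecke_of_pow_prime_eq_one`, `galoisHecke_of_keyLemma` — the existence
theorem in character form), ray-class Hecke characters (`HeckeCharacter.exists_of_isRayClassCharacter`),
rigidity (`HeckeCharacter.ext_of_eventually_valueAtUniformizer_eq`), and the Frobenius/splitting
dictionary of `FrobeniusDensityTheorem.lean`.

> Cox, *Primes of the form x² + ny²*, Thm. 8.10 (Hilbert class field): "there is a unique Abelian
> extension `L` of `K` such that all primes of `K` are unramified in `L` and … a prime splits
> completely in `L` iff it is principal" (with Cor. 5.21); Neukirch, *Bonn Lectures* III (7.8)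
> (existence theorem); *ANT* VI (6.9).

* (the tree's `HeckeCharacter.exists_eq_charHecke_of_isFiniteOrder`,
  `HeckeCharacterGaloisAvatarProofs.lean`: every finite-order Hecke character of `K : Type` is
  `χ ∘ ψ_{L|K}` for a finite abelian `L ⊆ K̄`);
* `mem_splitPrimes_of_le` — split primes decrease along `E ≤ H`;
* `exists_unramified_splitPrimes_of_classGroupChar` — for a character `ψ` of `Cl(𝓞_K)` a finite Galois
  `E ⊆ K̄`, unramified at every finite prime, in which every (unexceptional) completely split prime
  has `ψ([v]) = 1` (`E = L^{ker χ}` for `ω_ψ = χ ∘ ψ_{L|K}`);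
* `exists_hilbertClassField_data` — **for every number field `K : Type`: a finite Galois `H ⊆ K̄`,
  unramified over `𝓞_K` at every maximal ideal, in which all but finitely many completely split
  primes are principal** — exactly the hypothesis (HCF) of
  `Literature.NumberTheory.EllipticCurves.exists_unramified_formJ_of_hilbertClassField` and of
  `Literature.Barriers.ABC.OWeakUniformABCImpliesNoSiegelZeros.of_hilbertClassField_of_cubeSquare`,
  which are thereby discharged of their class-field-theoretic input.

(The converse inclusion — principal primes split completely in `H` — and `Gal(H/K) ≅ Cl(𝓞_K)` are
not needed downstream and not asserted.)

## References

* D. A. Cox, *Primes of the form x² + ny²*, 2nd ed. (2013), §5.C Cor. 5.21, §8.A Thm. 8.10. [Cox2013]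
* J. Neukirch, *Class Field Theory — The Bonn Lectures* (2013), Part III Thm. (7.8). [Neukirch2013]
* J. Neukirch, *Algebraic Number Theory* (1999), Ch. VI §6 (6.9), §7 (7.1). [NeukirchANT1999]
* J. Tate, *Global class field theory*, Ch. VII of Cassels–Fröhlich (1967), §5.1, §12. [CasselsFrohlichANT1967]
-/

noncomputable section

open NumberField IsDedekindDomain Filter Polynomial Field
open scoped IsMulCommutative nonZeroDivisors

namespace Literature.NumberTheory.NumberFields

open Literature.NumberTheory.GaloisRepresentations Literature.NumberTheory.Automorphic
  Literature.NumberTheory.LFunctions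

variable {K : Type} [Field K] [NumberField K]

/-- **Split primes decrease along subextensions**: for `E ≤ H ⊆ K̄`, both finite Galois over `K`, a
prime `v` unramified in `E` that splits completely in `H` splits completely in `E` (the Frobenius of
`H` above `v` is trivial, hence so is its restriction to `E`). [folklore] -/
theorem mem_splitPrimes_of_le {E H : IntermediateField K (AlgebraicClosure K)} (h : E ≤ H)
    [FiniteDimensional K H] [IsGalois K H] [IsGalois K E] {v : HeightOneSpectrum (𝓞 K)}
    (hunrE : Algebra.IsUnramifiedIn (𝓞 E) v.asIdeal) (hv : v ∈ splitPrimes K H) :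
    v ∈ splitPrimes K E := by
  classical
  haveI : FiniteDimensional K E :=
    FiniteDimensional.of_injective (IntermediateField.inclusion h).toLinearMap
      (RingHom.injective (IntermediateField.inclusion h).toRingHom)
  haveI : NumberField H := NumberField.of_module_finite K H
  haveI : NumberField E := NumberField.of_module_finite K E
  set E' : IntermediateField K H := IntermediateField.restrict h with hE'
  haveI : IsGalois K E' := IsGalois.of_algEquiv (IntermediateField.restrict_algEquiv h)
  haveI : NumberField E' := NumberField.of_module_finite K E'
  haveI : IsGalois K (⊤ : IntermediateField K H) :=
    IsGalois.of_algEquiv (IntermediateField.topEquiv (F := K) (E := H)).symm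
  haveI : NumberField (⊤ : IntermediateField K H) := NumberField.of_module_finite K _
  have hunrH : Algebra.IsUnramifiedIn (𝓞 H) v.asIdeal := hv.1
  -- a prime of `𝓞 H` above `v` and its Frobenius
  haveI := v.isMaximal
  obtain ⟨Q, hQmax, hQover⟩ := Ideal.exists_maximal_ideal_liesOver_of_isIntegral (S := 𝓞 H) v.asIdeal
  haveI := hQmax
  have hQ : Q ∈ v.asIdeal.primesOver (𝓞 H) := ⟨hQmax.isPrime, hQover⟩
  have hQbot : Q ≠ ⊥ := Ideal.ne_bot_of_liesOver_of_ne_bot v.ne_bot Q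
  obtain ⟨φ, hφ⟩ := exists_isArithFrobAt_ringOfIntegers (M := K) Q hQbot
  -- `φ = 1` since `v` splits completely in `H`
  have hunrT : Algebra.IsUnramifiedIn (𝓞 (⊤ : IntermediateField K H)) v.asIdeal :=
    isUnramifiedIn_of_algEquiv (RingOfIntegers.mapAlgEquiv (IntermediateField.topEquiv (F := K) (E := H)))
      v.ne_bot hunrH
  have hvT : v ∈ splitPrimes K (⊤ : IntermediateField K H) := by
    rw [Literature.NumberTheory.EllipticCurves.splitPrimes_eq_of_algEquiv
      (IntermediateField.topEquiv (F := K) (E := H))]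
    exact hv
  have hφ1 : φ = 1 := by
    have := (mem_splitPrimes_intermediateField_iff (⊤ : IntermediateField K H) hunrH hunrT hQ hφ).mp hvT
    rwa [IntermediateField.fixingSubgroup_top, Subgroup.mem_bot] at this
  -- hence `v` splits completely in `E' ≅ E`
  have hunrE' : Algebra.IsUnramifiedIn (𝓞 E') v.asIdeal :=
    isUnramifiedIn_of_algEquiv (RingOfIntegers.mapAlgEquiv (IntermediateField.restrict_algEquiv h).symm)
      v.ne_bot hunrE
  have hvE' : v ∈ splitPrimes K E' :=
    (mem_splitPrimes_intermediateField_iff E' hunrH hunrE' hQ hφ).mpr (by rw [hφ1]; exact one_mem _)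
  rw [Literature.NumberTheory.EllipticCurves.splitPrimes_eq_of_algEquiv (IntermediateField.restrict_algEquiv h)]
  exact hvE'

/-- **The class field cut out by a class-group character.**  For a character `ψ` of `Cl(𝓞_K)` there
is a finite Galois `E ⊆ K̄` over `K`, unramified at every finite prime, such that every prime `v`
splitting completely in `E` has `ψ([v]) = 1`.  Construction: the Hecke character `ω_ψ` of the ray
class character `𝔭 ↦ ψ([𝔭])` of modulus `1` (`HeckeCharacter.exists_of_isRayClassCharacter`) is
`χ ∘ ψ_{L|K}` for a finite abelian `L` and a character `χ` of `Gal(L/K)`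
(`HeckeCharacter.exists_eq_charHecke_of_isFiniteOrder`); take `E = L^{ker χ}`.  It is unramified: an inertia element
`g` above `v` has `χ(g|_L) = 1` because the Hecke character of `χ ∘ r_L` given by primitive reciprocity
(`artinReciprocity_character_primitive_holds`) coincides with the everywhere unramified `ω_ψ`
(rigidity), so `χ ∘ r_L` is unramified; and `v` splits completely in `E` iff `Frob_v ∈ ker χ`, i.e.
`ψ([v]) = ω_ψ(ϖ_v) = χ(Frob_v) = 1`. [cite: Cox2013, §8.A Thm. 8.10] [cite: NeukirchANT1999, Ch. VI §6 (6.9) and §7 (7.1)] -/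
theorem exists_unramified_splitPrimes_of_classGroupChar (ψ : ClassGroup (𝓞 K) →* ℂˣ) :
    ∃ (E : IntermediateField K (AlgebraicClosure K)), FiniteDimensional K E ∧ IsGalois K E ∧
      (∀ v : HeightOneSpectrum (𝓞 K), Algebra.IsUnramifiedIn (𝓞 E) v.asIdeal) ∧
      ∀ᶠ v : HeightOneSpectrum (𝓞 K) in cofinite, v ∈ splitPrimes K E →
        ψ (ClassGroup.mk0 ⟨v.asIdeal, asIdeal_mem_nonZeroDivisors v⟩) = 1 := by
  classical
  set hR := artinReciprocity_character_holds
  -- the Hecke character of `ψ`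
  set ψ₀ : HeightOneSpectrum (𝓞 K) → ℂ :=
    fun v => (ψ (ClassGroup.mk0 ⟨v.asIdeal, asIdeal_mem_nonZeroDivisors v⟩) : ℂ) with hψ₀
  have hray : IsRayClassCharacter (⊤ : Ideal (𝓞 K)) ψ₀ := isRayClassCharacter_top_of_classGroupHom ψ
  obtain ⟨ω, hωfin, hω⟩ := HeckeCharacter.exists_of_isRayClassCharacter (𝔣 := ⊤) top_ne_bot hray
  have hnot : ∀ v : HeightOneSpectrum (𝓞 K), ¬ (⊤ : Ideal (𝓞 K)) ≤ v.asIdeal :=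
    fun v h => v.isPrime.ne_top (top_le_iff.mp h)
  -- it is Galois: `ω = χ ∘ ψ_{L|K}`
  obtain ⟨L, hLfd, hLab, χ, hωχ⟩ := HeckeCharacter.exists_eq_charHecke_of_isFiniteOrder ω hωfin
  haveI := hLfd
  haveI := hLab
  haveI : NumberField L := NumberField.of_module_finite K L
  have hcomm : ∀ a b : L ≃ₐ[K] L, Commute a b := commute_of_isAbelianGalois L
  -- `E = L^{ker χ}`
  haveI : (χ.ker).Normal := Subgroup.normal_of_isMulCommutative _
  set E₀ : IntermediateField K L := IntermediateField.fixedField χ.ker with hE₀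
  haveI : IsGalois K E₀ := IsGalois.of_fixedField_normal_subgroup χ.ker
  set E : IntermediateField K (AlgebraicClosure K) := IntermediateField.lift E₀ with hEdef
  have hEL : E ≤ L := IntermediateField.lift_le E₀
  haveI : FiniteDimensional K E :=
    FiniteDimensional.of_injective (IntermediateField.inclusion hEL).toLinearMap
      (RingHom.injective (IntermediateField.inclusion hEL).toRingHom)
  haveI : IsGalois K E := IsGalois.of_algEquiv (IntermediateField.liftAlgEquiv E₀)
  haveI : NumberField E := NumberField.of_module_finite K E
  haveI : NumberField E₀ := NumberField.of_module_finite K E₀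
  have hfixE₀ : E₀.fixingSubgroup = χ.ker := IntermediateField.fixingSubgroup_fixedField χ.ker
  -- the inflated character `ρ = χ ∘ r_L` is unramified everywhere
  set ρ : FramedArtinRep K 1 := inflateCharacter L χ with hρdef
  have hρunr : ∀ v : HeightOneSpectrum (𝓞 K), ρ.IsUnramifiedAt v := by
    obtain ⟨ω', -, hω'⟩ := artinReciprocity_character_primitive_holds (K := K) ρ
    have heq : ω' = ω := by
      apply HeckeCharacter.ext_of_eventually_valueAtUniformizer_eq
      have hunrL : ∀ᶠ v : HeightOneSpectrum (𝓞 K) in cofinite, Algebra.IsUnramifiedIn (𝓞 L) v.asIdeal :=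
        Filter.eventually_cofinite.mpr (finite_setOf_not_isUnramifiedIn K L)
      filter_upwards [hunrL] with v hunr
      have hρv : ρ.IsUnramifiedAt v := inflateCharacter_isUnramifiedAt L χ hunr
      obtain ⟨𝔓v, h𝔓v⟩ := v.primesAbove_nonempty
      obtain ⟨σ, hσ⟩ := HeightOneSpectrum.exists_isArithFrobAt_of_mem_primesAbove_holds h𝔓v
      rw [(hω' v).2 hρv 𝔓v h𝔓v σ hσ, hωχ, charHecke_valueAtUniformizer L χ hR hunr]
      haveI : 𝔓v.IsPrime := h𝔓v.1
      have hP := comap_ringOfIntegersToIntegralClosure_mem_primesOver_of_mem_primesAbove L h𝔓v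
      have hrσ := isArithFrobAt_absRestrictNormalHom L hσ
      have hfrob : absRestrictNormalHom L σ = galFrob K L v := eq_galFrob hcomm hunr hP hrσ
      rw [FramedRep.det_apply, Matrix.GeneralLinearGroup.val_det_apply, Matrix.det_fin_one, hρdef,
        inflateCharacter_apply_coe, hfrob]
    intro v
    have h := (hω' v).1
    rw [heq] at h
    exact h.mp (hω v (hnot v)).1
  refine ⟨E, inferInstance, inferInstance, ?_, ?_⟩
  · -- unramified everywhere
    intro v
    by_contra hram
    obtain ⟨𝔓, h𝔓, g, hg, hne⟩ := exists_mem_inertia_absRestrictNormalHom_ne_one (L := E) hram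
    apply hne
    -- `χ(g|_L) = 1`, so `g|_L ∈ ker χ = Gal(L/E₀)` fixes `E₀`, hence `g` fixes `E`
    have h1 : ρ g = 1 := hρunr v 𝔓 h𝔓 g hg
    have h2 : absRestrictNormalHom L g ∈ χ.ker := by
      rw [MonoidHom.mem_ker]
      rw [hρdef, inflateCharacter_apply] at h1
      exact (FramedRep.unitsContinuousMulEquivOfUnique (Fin 1) ℂ).injective (by rw [h1, map_one])
    rw [← hfixE₀, IntermediateField.mem_fixingSubgroup_iff] at h2
    rw [absRestrictNormalHom_eq_one_iff, IntermediateField.mem_fixingSubgroup_iff]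
    intro x hx
    obtain ⟨y, hy, rfl⟩ := hx
    have hyE₀ : (y : L) ∈ E₀ := by simpa using hy
    have h3 := h2 y hyE₀
    have hr : ((absRestrictNormalHom L g y : L) : AlgebraicClosure K) = g • (y : AlgebraicClosure K) :=
      AlgEquiv.restrictNormalHom_apply L _ y
    have h4 : ((absRestrictNormalHom L g y : L) : AlgebraicClosure K) = (y : AlgebraicClosure K) :=
      congrArg (fun z : L => (z : AlgebraicClosure K)) h3
    rw [hr] at h4
    exact h4
  · -- splitting, off the primes ramified in `L`
    have hunrL : ∀ᶠ v : HeightOneSpectrum (𝓞 K) in cofinite, Algebra.IsUnramifiedIn (𝓞 L) v.asIdeal :=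
      Filter.eventually_cofinite.mpr (finite_setOf_not_isUnramifiedIn K L)
    filter_upwards [hunrL] with v hunrL hv
    -- transport to `E₀ ⊆ L`
    have hv₀ : v ∈ splitPrimes K E₀ := by
      rw [Literature.NumberTheory.EllipticCurves.splitPrimes_eq_of_algEquiv
        (IntermediateField.liftAlgEquiv E₀)]
      exact hv
    have hunrE₀ : Algebra.IsUnramifiedIn (𝓞 E₀) v.asIdeal := hv₀.1
    -- a prime of `𝓞 L` above `v`; its Frobenius lies in `ker χ`
    haveI := v.isMaximal
    obtain ⟨Q, hQmax, hQover⟩ := Ideal.exists_maximal_ideal_liesOver_of_isIntegral (S := 𝓞 L) v.asIdeal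
    haveI := hQmax
    have hQ : Q ∈ v.asIdeal.primesOver (𝓞 L) := ⟨hQmax.isPrime, hQover⟩
    have hQbot : Q ≠ ⊥ := Ideal.ne_bot_of_liesOver_of_ne_bot v.ne_bot Q
    obtain ⟨φ, hφ⟩ := exists_isArithFrobAt_ringOfIntegers (M := K) Q hQbot
    have hφker : φ ∈ χ.ker := by
      rw [← hfixE₀]
      exact (mem_splitPrimes_intermediateField_iff E₀ hunrL hunrE₀ hQ hφ).mp hv₀
    have hφeq : φ = galFrob K L v := eq_galFrob hcomm hunrL hQ hφ
    rw [MonoidHom.mem_ker, hφeq] at hφker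
    -- `ψ([v]) = ω(ϖ_v) = χ(Frob_v) = 1`
    have h1 := (hω v (hnot v)).2
    rw [hωχ, charHecke_valueAtUniformizer L χ hR hunrL, hφker, Units.val_one] at h1
    exact Units.val_injective (by rw [Units.val_one]; exact h1.symm)


/-- **The Hilbert class field, in the form (HCF).**  Every number field `K` has a finite Galois
extension `H ⊆ K̄`, unramified over `𝓞_K` at every maximal ideal, in which — with finitely many
exceptions — only principal primes split completely: `H` is the compositum of the class fields
`E_ψ` of the characters `ψ` of `Cl(𝓞_K)` (`exists_unramified_splitPrimes_of_classGroupChar`); an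
inertia element fixing every `E_ψ` fixes `H`, and a prime splitting completely in `H` splits
completely in every `E_ψ`, so `ψ([v]) = 1` for all `ψ`, i.e. `[v] = 1`.  (Hilbert's class field:
Cox Thm. 8.10 with Cor. 5.21; here from the tree's PROVED global class field theory — Artin
reciprocity for characters and Tate's existence theorem in character form.)
[cite: Cox2013, §8.A Thm. 8.10] [cite: Neukirch2013, Part III Thm. (7.8)] [cite: NeukirchANT1999, Ch. VI §6 Prop. (6.9)] -/
theorem exists_hilbertClassField_data (K : Type) [Field K] [NumberField K] :
    ∃ H : IntermediateField K (AlgebraicClosure K), FiniteDimensional K H ∧ IsGalois K H ∧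
      (∀ (P : Ideal (𝓞 H)) [P.IsMaximal], Algebra.IsUnramifiedAt (𝓞 K) P) ∧
      ∀ᶠ v : HeightOneSpectrum (𝓞 K) in cofinite, (Ideal.absNorm v.asIdeal).Prime →
        v ∈ splitPrimes K H → v.asIdeal.IsPrincipal := by
  classical
  -- finitely many characters of the class group; enough roots of unity in `ℂ`
  haveI : NeZero ((Monoid.exponent (ClassGroup (𝓞 K)) : ℕ) : ℂ) :=
    ⟨Nat.cast_ne_zero.mpr Monoid.exponent_ne_zero_of_finite⟩
  haveI : HasEnoughRootsOfUnity ℂ (Monoid.exponent (ClassGroup (𝓞 K))) := inferInstance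
  have hcard : Nat.card (ClassGroup (𝓞 K) →* ℂˣ) = Nat.card (ClassGroup (𝓞 K)) :=
    CommGroup.card_monoidHom_of_hasEnoughRootsOfUnity (ClassGroup (𝓞 K)) ℂ
  haveI : Finite (ClassGroup (𝓞 K) →* ℂˣ) :=
    Nat.finite_of_card_ne_zero (by rw [hcard]; exact Nat.card_pos.ne')
  choose E hE using fun ψ : ClassGroup (𝓞 K) →* ℂˣ => exists_unramified_splitPrimes_of_classGroupChar ψ
  haveI : ∀ ψ, FiniteDimensional K (E ψ) := fun ψ => (hE ψ).1
  haveI : ∀ ψ, IsGalois K (E ψ) := fun ψ => (hE ψ).2.1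
  set H : IntermediateField K (AlgebraicClosure K) := ⨆ ψ, E ψ with hHdef
  haveI : FiniteDimensional K H := by rw [hHdef]; infer_instance
  haveI : Normal K H := by rw [hHdef]; infer_instance
  haveI : IsGalois K H := IsGalois.mk
  haveI : NumberField H := NumberField.of_module_finite K H
  -- `H/K` is unramified at every finite prime
  have hunrH : ∀ v : HeightOneSpectrum (𝓞 K), Algebra.IsUnramifiedIn (𝓞 H) v.asIdeal := by
    intro v
    by_contra hram
    obtain ⟨𝔓, h𝔓, g, hg, hne⟩ := exists_mem_inertia_absRestrictNormalHom_ne_one (L := H) hram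
    apply hne
    rw [absRestrictNormalHom_eq_one_iff]
    have hfix : ∀ ψ, absoluteGaloisGroup.toAlgEquiv K g ∈ (E ψ).fixingSubgroup := fun ψ => by
      haveI : NumberField (E ψ) := NumberField.of_module_finite K _
      rw [← absRestrictNormalHom_eq_one_iff]
      exact absRestrictNormalHom_eq_one_of_isUnramifiedIn (E ψ) ((hE ψ).2.2.1 v) h𝔓 hg
    have hle : H ≤ IntermediateField.fixedField
        (Subgroup.zpowers (absoluteGaloisGroup.toAlgEquiv K g)) := by
      rw [hHdef]
      refine iSup_le fun ψ => ?_
      rw [IntermediateField.le_iff_le, Subgroup.zpowers_le]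
      exact hfix ψ
    rw [IntermediateField.le_iff_le, Subgroup.zpowers_le] at hle
    exact hle
  refine ⟨H, inferInstance, inferInstance, ?_, ?_⟩
  · intro P hP
    have hPbot : P ≠ ⊥ := Ring.ne_bot_of_isMaximal_of_not_isField hP (RingOfIntegers.not_isField H)
    have hvbot : P.under (𝓞 K) ≠ ⊥ := mt Ideal.eq_bot_of_comap_eq_bot hPbot
    set v : HeightOneSpectrum (𝓞 K) := ⟨P.under (𝓞 K), Ideal.IsPrime.under (𝓞 K) P, hvbot⟩ with hv
    exact hunrH v P hP.isPrime ⟨rfl⟩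
  · -- only principal primes split completely (off finitely many)
    have hall : ∀ᶠ v : HeightOneSpectrum (𝓞 K) in cofinite, ∀ ψ : ClassGroup (𝓞 K) →* ℂˣ,
        v ∈ splitPrimes K (E ψ) → ψ (ClassGroup.mk0 ⟨v.asIdeal, asIdeal_mem_nonZeroDivisors v⟩) = 1 :=
      Filter.eventually_all.mpr fun ψ => (hE ψ).2.2.2
    filter_upwards [hall] with v hv _ hsplit
    have h1 : ∀ ψ : ClassGroup (𝓞 K) →* ℂˣ, ψ (ClassGroup.mk0 ⟨v.asIdeal, asIdeal_mem_nonZeroDivisors v⟩) = 1 :=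
      fun ψ => hv ψ (mem_splitPrimes_of_le (by rw [hHdef]; exact le_iSup E ψ) ((hE ψ).2.2.1 v) hsplit)
    have h2 : ClassGroup.mk0 ⟨v.asIdeal, asIdeal_mem_nonZeroDivisors v⟩ = 1 := by
      by_contra hne
      obtain ⟨φ, hφ⟩ :=
        CommGroup.exists_apply_ne_one_of_hasEnoughRootsOfUnity (ClassGroup (𝓞 K)) ℂ hne
      exact hφ (h1 φ)
    exact (ClassGroup.mk0_eq_one_iff _).mp h2

end Literature.NumberTheory.NumberFields

end
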